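import Summits.AtomisticToContinuum.Crystallization.Theorems.FrustratedLawDichotomyAveragingRuleUnsplit

/-!
# FrustratedLawDichotomy · the CERTIFICATE FORMAT of the unsplit averaging feed: tight WITNESS or FLAG-FREE inequality — never a non-crystallinity proof

`…AveragingRuleUnsplit` (hand-2 g13, p829865): `AperiodicFrustratedLawGap ⟸ MuEquilibriumDoor ∧ SF₄₅ ∧ UP(−0.7175) ∧
TightFreeMotifPricingCapAt 0 ρ ϱ D W₄₅ (−0.7174 + 3/400)`.  At surcharge `κ_T = 0` and allowance `0` the capped surplus carries NO FLAG AT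
ALL: `x_j = ½·siteEnergy_W(j) − e` (`surplusCap_zero_zero_eq`).  Hence the family reads, motif by motif (`tightFreeMotifPricingCapAt_zero_iff_cert`):

  for every injective `7/10`-separated motif `z` confined to radius `ϱ` about its centre `c`:
  EITHER some site of `B(c,ρ)` is capped-tightly-good (`GoodAtScale (1/20) D` — a CONSTRUCTIVE witness: scale `d ≤ D`, isometry `A`, matching `t`;
         then tight absorption, PROVED, pays for the ball),
  OR the FLAG-FREE real inequality `0 ≤ Σ_{j ∈ B(c,ρ)} (½·siteEnergy_W(z,j) − e) / #B(j,ρ)` holds (interval arithmetic on the positions).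

So a census certificate for column 27623 through the flat rule NEVER has to certify that a site is NOT crystalline (the undecidable-looking
direction of the two-shell fit predicate never arises): every cell of a cover of motif space is discharged by a goodness WITNESS or by a
closed-form inequality in the pair distances.  `D` enters only through the witness (`nn ≤ D`) and the locality radius.
Kernels BY NAME: ★★ `aperiodicFrustratedLawGap_fourHalf_of_cert` (+ finite motif sizes `…_of_cert_bounded`, one-shell literal, stmt-27624 sibling).

[folklore] bookkeeping; 0 sorry; DEF-FREE.  Prover hand 2, gen 13 (decomp-a2c), `--supports stmt-AtomisticToContinuum-27623`.
-/

noncomputable section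

namespace Summit.AtomisticToContinuum.Crystallization.Theorems.FrustratedLawDichotomyAveragingRuleCertFormat

open scoped BigOperators Classical
open Literature.MathematicalPhysics.StatisticalMechanics (siteEnergy)
open Summit.AtomisticToContinuum.Crystallization.Theorems.ChargedEnergyGapNegative (E3)
open Summit.AtomisticToContinuum.Crystallization.Theorems.FrustratedLawDichotomyRangeCut
open Summit.AtomisticToContinuum.Crystallization.Theorems.FrustratedLawDichotomySchurCut
open Summit.AtomisticToContinuum.Crystallization.Theorems.FrustratedLawDichotomyMotifLemmas
open Summit.AtomisticToContinuum.Crystallization.Theorems.FrustratedLawDichotomyMotifCount (motif_card_le)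
open Summit.AtomisticToContinuum.Crystallization.Theorems.FrustratedLawDichotomyRuleToolkit
open Summit.AtomisticToContinuum.Crystallization.Theorems.FrustratedLawDichotomyRuleToolkitGood
open Summit.AtomisticToContinuum.Crystallization.Theorems.FrustratedLawDichotomyAveragingCut (ball ballAvg mem_ball)
open Summit.AtomisticToContinuum.Crystallization.Theorems.FrustratedLawDichotomyAveragingRule
open Summit.AtomisticToContinuum.Crystallization.Theorems.FrustratedLawDichotomyAveragingRuleCap
open Summit.AtomisticToContinuum.Crystallization.Theorems.FrustratedLawDichotomyAveragingRuleTightFree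
open Summit.AtomisticToContinuum.Crystallization.Theorems.FrustratedLawDichotomyAveragingRuleUnsplit

/-- ★ **At surcharge `0` and allowance `0` the capped surplus is FLAG-FREE**: `x_j = ½·siteEnergy_W(j) − e`. [folklore] -/
theorem surplusCap_zero_zero_eq (η₀ η₁ D : ℝ) (W : ℝ → ℝ) (e : ℝ) {M : ℕ} (z : Fin M → E3) (j : Fin M) :
    surplusCap η₀ η₁ D W e 0 0 M z j = siteEnergy W z j / 2 - e := by
  unfold surplusCap pairSumFeature
  rw [siteEnergy_eq]
  ring

/-- Hence its ball average is the flag-free average. [folklore] -/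
theorem ballAvg_surplusCap_zero_zero_eq (ρ η₀ η₁ D : ℝ) (W : ℝ → ℝ) (e : ℝ) {M : ℕ} (z : Fin M → E3) (c : Fin M) :
    ballAvg ρ z (surplusCap η₀ η₁ D W e 0 0 M z) c = ballAvg ρ z (fun j => siteEnergy W z j / 2 - e) c := by
  unfold ballAvg
  exact Finset.sum_congr rfl fun j _ => by rw [surplusCap_zero_zero_eq]

/-- ★★ **THE CERTIFICATE FORMAT**: the unsplit `C`-free family ⟺ «for every motif: a capped-tight WITNESS within `ρ` of the centre, OR the
flag-free inequality `0 ≤ Σ_{j ∈ B(c,ρ)} (½·siteEnergy_W(j) − e)/#B(j,ρ)`». [folklore] -/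
theorem tightFreeMotifPricingCapAt_zero_iff_cert {ρ ϱ D : ℝ} {W : ℝ → ℝ} {e : ℝ} :
    TightFreeMotifPricingCapAt 0 ρ ϱ D W e ↔
      ∀ (M : ℕ) (z : Fin M → E3), Function.Injective z → Sep z → ∀ c : Fin M, (∀ a : Fin M, dist (z a) (z c) ≤ ϱ) →
        (∃ j ∈ ball ρ z c, GoodAtScale (1 / 20) D z j) ∨ 0 ≤ ballAvg ρ z (fun j => siteEnergy W z j / 2 - e) c := by
  unfold TightFreeMotifPricingCapAt TightNearCap
  refine forall_congr' fun M => forall_congr' fun z => forall_congr' fun _ => forall_congr' fun _ => forall_congr' fun c =>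
    forall_congr' fun _ => ?_
  rw [ballAvg_surplusCap_zero_zero_eq]
  constructor
  · intro h
    by_cases ht : ∃ j ∈ ball ρ z c, GoodAtScale (1 / 20) D z j
    · exact Or.inl ht
    · exact Or.inr (h ht)
  · rintro (h | h) ht
    · exact absurd h ht
    · exact h

/-- **Finite in the motif size** (`ϱ ≥ 0`): the same with `M ≤ (20ϱ/7 + 1)³`. [folklore] -/
theorem tightFreeMotifPricingCapAt_zero_iff_cert_bounded {ρ ϱ D : ℝ} {W : ℝ → ℝ} {e : ℝ} (hϱ : 0 ≤ ϱ) :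
    TightFreeMotifPricingCapAt 0 ρ ϱ D W e ↔
      ∀ (M : ℕ), (M : ℝ) ≤ (20 * ϱ / 7 + 1) ^ 3 → ∀ (z : Fin M → E3), Function.Injective z → Sep z → ∀ c : Fin M,
        (∀ a : Fin M, dist (z a) (z c) ≤ ϱ) →
          (∃ j ∈ ball ρ z c, GoodAtScale (1 / 20) D z j) ∨ 0 ≤ ballAvg ρ z (fun j => siteEnergy W z j / 2 - e) c := by
  rw [tightFreeMotifPricingCapAt_zero_iff_cert]
  exact ⟨fun h M _ z hz hsep c hconf => h M z hz hsep c hconf,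
    fun h M z hz hsep c hconf => h M (motif_card_le hϱ hz hsep hconf) z hz hsep c hconf⟩

/-- ★★ **The crux `AperiodicFrustratedLawGap` (stmt-27623) BY NAME from a CERTIFICATE in this format** (record node `W₄₅ = effPot w₄₅ ω₄ (3/400)`,
level `e = −0.7174 + 3/400`; `0 ≤ ρ ≤ ρ₁`, `9/2 ≤ ρ₁`, `13/10·D + 1 ≤ ρ₁`, `ρ + ρ₁ ≤ ϱ`):
`MuEquilibriumDoor ∧ SF₄₅ ∧ UP(−0.7175) ∧ [every Sep radius-ϱ motif: tight witness within ρ of the centre ∨ flag-free average ≥ 0] ⟹ crux`.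
[folklore chaining] -/
theorem aperiodicFrustratedLawGap_fourHalf_of_cert {ρ ρ₁ ϱ D : ℝ}
    (hDoor : Summit.AtomisticToContinuum.Crystallization.Theses.GrainCoreNetworkSplit.MuEquilibriumDoor)
    (hSF : SF₄₅) (hU : PeriodicEnergyCeiling (-(7175 / 10000)))
    (h0 : 0 ≤ ρ) (hρ : ρ ≤ ρ₁) (hR : 9 / 2 ≤ ρ₁) (hD : 13 / 10 * D + 1 ≤ ρ₁) (hϱ : ρ + ρ₁ ≤ ϱ)
    (h : ∀ (M : ℕ) (z : Fin M → E3), Function.Injective z → Sep z → ∀ c : Fin M, (∀ a : Fin M, dist (z a) (z c) ≤ ϱ) →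
      (∃ j ∈ ball ρ z c, GoodAtScale (1 / 20) D z j) ∨
        0 ≤ ballAvg ρ z (fun j => siteEnergy (effPot w₄₅ ω₄ (3 / 400)) z j / 2 - (-(7174 / 10000) + 3 / 400)) c) :
    Summit.AtomisticToContinuum.Crystallization.Theses.FrustratedLawDichotomy.AperiodicFrustratedLawGap :=
  aperiodicFrustratedLawGap_fourHalf_of_tightFreeMotifCap_unsplit hDoor hSF hU h0 hρ hR hD hϱ
    (tightFreeMotifPricingCapAt_zero_iff_cert.2 h)

/-- **The same from a certificate listing only motif sizes `M ≤ (20ϱ/7 + 1)³`.** [folklore chaining] -/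
theorem aperiodicFrustratedLawGap_fourHalf_of_cert_bounded {ρ ρ₁ ϱ D : ℝ}
    (hDoor : Summit.AtomisticToContinuum.Crystallization.Theses.GrainCoreNetworkSplit.MuEquilibriumDoor)
    (hSF : SF₄₅) (hU : PeriodicEnergyCeiling (-(7175 / 10000)))
    (h0 : 0 ≤ ρ) (hρ : ρ ≤ ρ₁) (hR : 9 / 2 ≤ ρ₁) (hD : 13 / 10 * D + 1 ≤ ρ₁) (hϱ : ρ + ρ₁ ≤ ϱ)
    (h : ∀ (M : ℕ), (M : ℝ) ≤ (20 * ϱ / 7 + 1) ^ 3 → ∀ (z : Fin M → E3), Function.Injective z → Sep z → ∀ c : Fin M,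
      (∀ a : Fin M, dist (z a) (z c) ≤ ϱ) →
        (∃ j ∈ ball ρ z c, GoodAtScale (1 / 20) D z j) ∨
          0 ≤ ballAvg ρ z (fun j => siteEnergy (effPot w₄₅ ω₄ (3 / 400)) z j / 2 - (-(7174 / 10000) + 3 / 400)) c) :
    Summit.AtomisticToContinuum.Crystallization.Theses.FrustratedLawDichotomy.AperiodicFrustratedLawGap :=
  aperiodicFrustratedLawGap_fourHalf_of_tightFreeMotifCap_unsplit hDoor hSF hU h0 hρ hR hD hϱ
    ((tightFreeMotifPricingCapAt_zero_iff_cert_bounded (by linarith)).2 h)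

/-- **One-shell literal** (`ρ = 23/20`, `D = 23/10`, `ρ₁ = 9/2`, `ϱ = 113/20`; motifs of `≤ (120/7)³ < 5039` atoms). [folklore chaining] -/
theorem aperiodicFrustratedLawGap_fourHalf_of_cert_oneShell
    (hDoor : Summit.AtomisticToContinuum.Crystallization.Theses.GrainCoreNetworkSplit.MuEquilibriumDoor)
    (hSF : SF₄₅) (hU : PeriodicEnergyCeiling (-(7175 / 10000)))
    (h : ∀ (M : ℕ), (M : ℝ) ≤ (20 * (113 / 20 : ℝ) / 7 + 1) ^ 3 → ∀ (z : Fin M → E3), Function.Injective z → Sep z → ∀ c : Fin M,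
      (∀ a : Fin M, dist (z a) (z c) ≤ 113 / 20) →
        (∃ j ∈ ball (23 / 20) z c, GoodAtScale (1 / 20) (23 / 10) z j) ∨
          0 ≤ ballAvg (23 / 20) z (fun j => siteEnergy (effPot w₄₅ ω₄ (3 / 400)) z j / 2 - (-(7174 / 10000) + 3 / 400)) c) :
    Summit.AtomisticToContinuum.Crystallization.Theses.FrustratedLawDichotomy.AperiodicFrustratedLawGap :=
  aperiodicFrustratedLawGap_fourHalf_of_cert_bounded (ρ₁ := 9 / 2) hDoor hSF hU (by norm_num) (by norm_num) le_rfl (by norm_num) (by norm_num) h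

/-- **The periodic sibling `PeriodicFrustratedLawGap` (stmt-27624) from the same certificate.** [folklore chaining] -/
theorem periodicFrustratedLawGap_fourHalf_of_cert {ρ ρ₁ ϱ D : ℝ}
    (hDoor : Summit.AtomisticToContinuum.Crystallization.Theses.GrainCoreNetworkSplit.MuEquilibriumDoor)
    (hSF : SF₄₅) (hU : PeriodicEnergyCeiling (-(7175 / 10000)))
    (h0 : 0 ≤ ρ) (hρ : ρ ≤ ρ₁) (hR : 9 / 2 ≤ ρ₁) (hD : 13 / 10 * D + 1 ≤ ρ₁) (hϱ : ρ + ρ₁ ≤ ϱ)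
    (h : ∀ (M : ℕ) (z : Fin M → E3), Function.Injective z → Sep z → ∀ c : Fin M, (∀ a : Fin M, dist (z a) (z c) ≤ ϱ) →
      (∃ j ∈ ball ρ z c, GoodAtScale (1 / 20) D z j) ∨
        0 ≤ ballAvg ρ z (fun j => siteEnergy (effPot w₄₅ ω₄ (3 / 400)) z j / 2 - (-(7174 / 10000) + 3 / 400)) c) :
    Summit.AtomisticToContinuum.Crystallization.Theses.FrustratedLawDichotomy.PeriodicFrustratedLawGap :=
  periodicFrustratedLawGap_fourHalf_of_tightFreeMotifCap_unsplit hDoor hSF hU h0 hρ hR hD hϱ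
    (tightFreeMotifPricingCapAt_zero_iff_cert.2 h)

end Summit.AtomisticToContinuum.Crystallization.Theorems.FrustratedLawDichotomyAveragingRuleCertFormat

end
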